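import Literature.Probability.Percolation.CornerPercolation
import Literature.Probability.Percolation.IsoradialProofs
import Literature.Probability.LatticeModels.ProdBernoulliIndependence
import HarnessLib

/-!
# Stub `stub_indepBoxes` of line `Sketch`, crux `SegmentClosed` (stmt-CriticalPhenomena-5473)

Top–bottom crossings of `K` lattice boxes `w k + [0, a] × [0, b]` of `√2 ℤ²` with pairwise
disjoint column ranges are independent under the corner model `M_t = cornerPercolation t`
(`= (prodBernoulli (cornerParam t)).map cornerConfig`):

* the crossing event `E_k` of the box `k` is determined, on the bond level, by the pairs of
  vertices of its finite vertex box `S_k` (`PlanarDuality.determinedBy_openCrossing`);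
* an east / north edge of `ℤ²` is open in `cornerConfig T` iff a condition on `T` at its base
  vertex holds, and the base vertex is an endpoint, so `cornerConfig ⁻¹' E_k` is determined by
  the coordinates `S_k × {0, 1}` (`determinedBy_preimage_cornerConfig`);
* the boxes `S_k` are pairwise disjoint, so the product formula
  `prodBernoulli_real_inter_biInter_of_determinedBy` gives
  `M_t(⋃ E_k) = 1 - ∏ (1 - M_t(E_k)) ≥ 1 - (1 - c)^K`.
-/

noncomputable section

open Set Filter Metric MeasureTheory Complex
open scoped Topology
open Literature.Probability.RandomPlanarGeometry Literature.Probability.Percolation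
open Literature.Probability.LatticeModels

namespace Summit.CriticalPhenomena.CardyFormulaZ2.Cruxes.SegmentClosed.Sketch

/-! ### Locality of the corner map -/

/-- The complement of an event determined by `F` is determined by `F`. -/
private theorem determinedBy_compl_of {ι : Type*} {A : Set (Set ι)} {F : Set ι}
    (h : DeterminedBy A F) : DeterminedBy Aᶜ F := by
  rw [determinedBy_iff] at h ⊢
  intro ω ω' hω
  rw [Set.mem_compl_iff, Set.mem_compl_iff, h ω ω' hω]

/-- **Locality of the corner map.** If a bond event `A` on `ℤ²` is determined by the pairs of
vertices of `S`, then `cornerConfig ⁻¹' A` is determined by the coins and splitting bits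
`S × {0, 1}` of the vertices of `S`: the east edge `{v, v + e₀}` (resp. north edge
`{v, v + e₁}`) is open in `cornerConfig T` iff a condition on `T` at `(v, 0)`, `(v, 1)` holds,
and its base vertex `v` is one of its endpoints, hence lies in `S` when the edge is a pair of
vertices of `S`. -/
private theorem determinedBy_preimage_cornerConfig {A : Set (BondConfig (Site 2))}
    {S : Set (Site 2)} (h : DeterminedBy A S.sym2) :
    DeterminedBy (cornerConfig ⁻¹' A) (S ×ˢ (Set.univ : Set (Fin 2))) := by
  rw [determinedBy_iff] at h ⊢
  intro T T' hT
  have hco : ∀ v ∈ S, ∀ j : Fin 2, ((v, j) ∈ T ↔ (v, j) ∈ T') := fun v hv j =>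
    ⟨fun h1 => ((Set.ext_iff.1 hT (v, j)).1 ⟨h1, Set.mk_mem_prod hv (Set.mem_univ _)⟩).1,
      fun h1 => ((Set.ext_iff.1 hT (v, j)).2 ⟨h1, Set.mk_mem_prod hv (Set.mem_univ _)⟩).1⟩
  have key : ∀ e ∈ S.sym2, (e ∈ cornerConfig T ↔ e ∈ cornerConfig T') := by
    intro e he
    simp only [mem_cornerConfig_iff]
    refine exists_congr fun v => or_congr ?_ ?_
    · refine and_congr_right fun hev => ?_
      subst hev
      exact hco v (Set.mk_mem_sym2_iff.1 he).1 0
    · refine and_congr_right fun hev => ?_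
      subst hev
      have hv : v ∈ S := (Set.mk_mem_sym2_iff.1 he).1
      rw [hco v hv 0, hco v hv 1]
  simp only [Set.mem_preimage]
  refine h _ _ (Set.ext fun e => ?_)
  simp only [Set.mem_inter_iff]
  constructor
  · rintro ⟨he, heS⟩
    exact ⟨(key e heS).1 he, heS⟩
  · rintro ⟨he, heS⟩
    exact ⟨(key e heS).2 he, heS⟩

/-! ### The vertex boxes are finite -/

/-- The vertex box `{v | √2 v - w ∈ [0, a] × [-2, b + 2]}` of the event
`embTBCrossing (√2 · - w) a b` is a finite set of lattice points (it lies in an order interval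
of `ℤ²`; coordinates of `√2 v - w` by `squareLatticeEmbedding_z_sub_re/im`). -/
private theorem finite_tbBox (w : ℂ) (a b : ℝ) :
    {v : Site 2 | (squareLatticeEmbedding.z v - w).re ∈ Icc 0 a ∧
      (squareLatticeEmbedding.z v - w).im ∈ Icc (-2) (b + 2)}.Finite := by
  have hs : (0 : ℝ) < Real.sqrt 2 := Real.sqrt_pos.2 (by norm_num)
  refine (Set.finite_Icc (![⌈w.re / Real.sqrt 2⌉, ⌈(w.im - 2) / Real.sqrt 2⌉] : Site 2)
    ![⌊(w.re + a) / Real.sqrt 2⌋, ⌊(w.im + b + 2) / Real.sqrt 2⌋]).subset ?_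
  rintro v ⟨⟨h1, h2⟩, h3, h4⟩
  rw [squareLatticeEmbedding_z_sub_re] at h1 h2
  rw [squareLatticeEmbedding_z_sub_im] at h3 h4
  simp only [Set.mem_Icc, Pi.le_def, Fin.forall_fin_two, Matrix.cons_val_zero,
    Matrix.cons_val_one]
  refine ⟨⟨Int.ceil_le.2 ?_, Int.ceil_le.2 ?_⟩, Int.le_floor.2 ?_, Int.le_floor.2 ?_⟩
  · rw [div_le_iff₀ hs]; linarith
  · rw [div_le_iff₀ hs]; linarith
  · rw [le_div_iff₀ hs]; linarith
  · rw [le_div_iff₀ hs]; linarith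

/-! ### Independence of events with disjoint supports under `M_t` -/

/-- **Union bound from independence.** If the bond events `E k` (`k < K`) are measurable, their
preimages under the corner map are determined by pairwise disjoint finite sets `T k` of
coordinates, and each has `M_t`-probability at least `c`, then
`M_t(⋃ E_k) = 1 - ∏ (1 - M_t(E_k)) ≥ 1 - (1 - c)^K`. -/
private theorem real_iUnion_ge_of_determinedBy {K : ℕ} (t : unitInterval)
    (E : Fin K → Set (BondConfig (Site 2))) (T : Fin K → Finset (Site 2 × Fin 2))
    (hdisj : (↑(Finset.univ : Finset (Fin K)) : Set (Fin K)).PairwiseDisjoint T)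
    (hdet : ∀ k, DeterminedBy (cornerConfig ⁻¹' E k) ↑(T k))
    (hEm : ∀ k, MeasurableSet (E k)) {c : ℝ}
    (hc : ∀ k, c ≤ (cornerPercolation t).real (E k)) :
    1 - (1 - c) ^ K ≤ (cornerPercolation t).real (⋃ k, E k) := by
  classical
  have hCm : ∀ k, MeasurableSet (cornerConfig ⁻¹' E k) := fun k =>
    measurable_cornerConfig (hEm k)
  have hprod := prodBernoulli_real_inter_biInter_of_determinedBy (cornerParam t) Finset.univ T
    hdisj (C := fun k => (cornerConfig ⁻¹' E k)ᶜ) (fun k _ => determinedBy_compl_of (hdet k))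
    (fun k _ => (hCm k).compl) (determinedBy_univ _) MeasurableSet.univ
  rw [Set.univ_inter, probReal_univ, one_mul] at hprod
  have hUm : MeasurableSet (⋃ k, E k) := MeasurableSet.iUnion hEm
  have hU : (cornerPercolation t).real (⋃ k, E k) =
      1 - ∏ k, (1 - (cornerPercolation t).real (E k)) := by
    have h1 : (cornerPercolation t).real (⋃ k, E k) =
        1 - (cornerPercolation t).real (⋃ k, E k)ᶜ := by
      rw [probReal_compl_eq_one_sub hUm]; ring
    rw [h1, cornerPercolation_real_apply t hUm.compl, Set.preimage_compl, Set.preimage_iUnion,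
      Set.compl_iUnion]
    congr 1
    have h2 : (⋂ k, (cornerConfig ⁻¹' E k)ᶜ) =
        ⋂ k ∈ (Finset.univ : Finset (Fin K)), (cornerConfig ⁻¹' E k)ᶜ := by
      simp only [Finset.mem_univ, Set.iInter_true]
    rw [h2, hprod]
    refine Finset.prod_congr rfl fun k _ => ?_
    rw [probReal_compl_eq_one_sub (hCm k), cornerPercolation_real_apply t (hEm k)]
  rw [hU]
  have hle : ∏ k, (1 - (cornerPercolation t).real (E k)) ≤ (1 - c) ^ K := by
    calc ∏ k, (1 - (cornerPercolation t).real (E k)) ≤ ∏ _k : Fin K, (1 - c) :=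
          Finset.prod_le_prod (fun k _ => sub_nonneg.2 measureReal_le_one)
            (fun k _ => by linarith [hc k])
      _ = (1 - c) ^ K := by rw [Finset.prod_const, Finset.card_univ, Fintype.card_fin]
  linarith

/-! ### The stub -/

/-- **Independent boxes.** Top–bottom crossings of lattice boxes `w k + [0, a] × [0, b]` with
pairwise disjoint column ranges are independent under the corner model `M_t` (each is determined
by the coins and splitting bits of the vertices of its own box, and `M_t` is a product measure
pushed forward by the corner map), so if each has probability `≥ c` their union has probability
`≥ 1 - (1 - c)^K` (`prodBernoulli_real_inter_biInter_of_determinedBy`). -/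
theorem stub_indepBoxes (t : unitInterval) {K : ℕ} (w : Fin K → ℂ) {a b c : ℝ} (ha : 0 ≤ a)
    (hsep : ∀ i j : Fin K, i ≠ j → (w i).re + a < (w j).re ∨ (w j).re + a < (w i).re)
    (hc : ∀ k, c ≤ (cornerPercolation t).real
      (embTBCrossing (fun v => squareLatticeEmbedding.z v - w k) a b)) :
    1 - (1 - c) ^ K ≤ (cornerPercolation t).real
      (⋃ k, embTBCrossing (fun v => squareLatticeEmbedding.z v - w k) a b) := by
  classical
  -- `ha : 0 ≤ a` belongs to the registered signature but is not needed below (for `a < 0` the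
  -- vertex boxes, hence the events, are empty); it is referenced once and discarded.
  have _ha := ha
  refine real_iUnion_ge_of_determinedBy t _
    (fun k => (finite_tbBox (w k) a b).toFinset ×ˢ Finset.univ) ?_ ?_
    (fun k => measurableSet_openCrossing_of_countable _ _ _) hc
  · -- the coordinate boxes are pairwise disjoint (disjoint column ranges)
    intro i _ j _ hij
    simp only [Function.onFun]
    rw [Finset.disjoint_left]
    rintro ⟨v, l⟩ hi hj
    simp only [Finset.mem_product, Set.Finite.mem_toFinset, Set.mem_setOf_eq, Set.mem_Icc,
      Finset.mem_univ, and_true] at hi hj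
    obtain ⟨⟨h1, h2⟩, -⟩ := hi
    obtain ⟨⟨h3, h4⟩, -⟩ := hj
    rw [Complex.sub_re] at h1 h2 h3 h4
    rcases hsep i j hij with h | h <;> linarith
  · -- each preimage is determined by the coordinates of its own box
    intro k
    rw [Finset.coe_product, Finset.coe_univ, Set.Finite.coe_toFinset]
    refine determinedBy_preimage_cornerConfig ?_
    have := PlanarDuality.determinedBy_openCrossing (finite_tbBox (w k) a b).toFinset
      {v | (squareLatticeEmbedding.z v - w k).im ≤ 0}
      {v | b ≤ (squareLatticeEmbedding.z v - w k).im}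
    rw [Finset.coe_sym2, Set.Finite.coe_toFinset] at this
    exact this

end Summit.CriticalPhenomena.CardyFormulaZ2.Cruxes.SegmentClosed.Sketch
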